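import Summits.BirchSwinnertonDyer.BirchSwinnertonDyer.Theorems.KolyvaginRoadThreePTDevissageLift
import Summits.BirchSwinnertonDyer.BirchSwinnertonDyer.Theorems.SchneiderFreeAdditiveX3PoitouTateBidualTransport
import HarnessLib

/-!
# DÉVISSAGE of Milne I Thm. 4.10(b) `Ker γ¹ ⊆ Im β¹` along a short exact sequence
# `0 → M₁ → M₂ → M₃ → 0` with vanishing obstruction groups

For a number field `K`, a family `inv` of local invariant maps (perfect at the finite places, injective
at the real places, Milne I 2.6, reciprocity `∑_v ⟨x_v, y_v⟩_v = 0`), a short exact sequence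
`0 → M₁ →(f) M₂ →(g) M₃ → 0` of finite discrete `n`-torsion `Γ_K`-modules with its dual
`0 → M₃^D →(g^D) M₂^D →(f^D) M₁^D → 0`, and a finite `S ⊇ {v ∣ ∞}` off which `v ∤ n` and the modules are
unramified: **the basic middle exactness for `(M₂, S)`** — every family `t ∈ ⊕_{v∈S} H¹(K_v, M₂)`
orthogonal to `loc(H¹_S(K, M₂^D))` is `loc` of a class of `H¹_S(K, M₂)` — **follows from the middle
exactness of `M₁` (all `S' ⊇ S`), of `M₃` (at `S`) and of `M₃^D` (all `S' ⊇ S`), granted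
`Ш²(K, M₁) = 0`, `Ш²(K, M₃^D) = 0` and the vanishing of the classes of `M₁^D`, resp. `M₃^{DD}`, which are
trivial on `S` and unramified off `S`** (`middleExact_of_extension`).

This is the length-`2` dévissage that bsd-schneider's FINDING-door-c6-g7 §4 identified as the one
unconditional case (both obstruction groups are `Ш²(K, μₚ) = 0` when the pieces are `μₚ ≅ ℤ/p`), now a
kernel theorem; with the 3-Sylow descent it reaches `E[p]` for every elliptic curve (the PT stub of crux
`ZhangSharpFrameAtThreeHL`, which needs `M = E[3]`).  Proof = Steps 1–4 of the module docstrings of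
`…PTDevissageLift` / `…PTDevissageDuality`: push `t` to `M₃` and solve there; lift the solution
`S`-unramified (lifting lemma for `(f, g)`); the defect on `S` lies in `H¹(f)(⊕ H¹(K_v, M₁))` and is
corrected by Howard's Thm. 2.1.11 for `M₁` with `𝓕_v = ker H¹(f_v)`, whose orthogonality test classes
`y ∈ H¹_{𝓕*}(K, M₁^D)` lift `S`-unramified to `H¹(K, M₂^D)` (local `(ker H¹(f))^⊥ = im H¹(f^D)` and the
lifting lemma for `(g^D, f^D)`), where reciprocity and the hypothesis on `t` conclude.
Theorems only; no case of BSD.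

References: [MilneADT2006] I Thm. 4.10(b), Lemma 4.8, Thm. 2.6, Prop. 0.19;
[Howard2004HeegnerKolyvagin] Thm. 2.1.11 (arXiv:1202.6340 p. 6).
-/

noncomputable section

open CategoryTheory Function NumberField IsDedekindDomain
open scoped NumberField ContRepresentation

universe u

set_option linter.dupNamespace false
set_option autoImplicit false

namespace Summit.BirchSwinnertonDyer.BirchSwinnertonDyer.Theorems.KolyvaginRoadThreePT

open Field
open Literature.NumberTheory.GaloisRepresentations Literature.NumberTheory.GaloisCohomology
open Literature.NumberTheory.GaloisRepresentations.DiscreteGaloisModule (mu MuCarrier TateDual tateDual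
  localTatePairingZMod homOfIntertwining unramifiedSubgroup SelmerStructure)
open _root_.TopRep _root_.ContRepresentation _root_.ContinuousCohomology
open Summit.BirchSwinnertonDyer.Rank1Residual.X11b.FiniteDuality
open Summit.BirchSwinnertonDyer.BirchSwinnertonDyer.Theorems.SchneiderFreeAdditiveX3.PoitouTateReduction

variable {K : Type u} [Field K] [NumberField K] {n : ℕ} [NeZero n]
variable {M₁ M₂ M₃ : Type u}
  [AddCommGroup M₁] [TopologicalSpace M₁] [DiscreteTopology M₁] [Finite M₁]
  [AddCommGroup M₂] [TopologicalSpace M₂] [DiscreteTopology M₂] [Finite M₂]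
  [AddCommGroup M₃] [TopologicalSpace M₃] [DiscreteTopology M₃] [Finite M₃]
variable {ρ₁ : DiscreteGaloisModule K M₁} {ρ₂ : DiscreteGaloisModule K M₂}
  {ρ₃ : DiscreteGaloisModule K M₃}

omit [NeZero n] [Finite M₁] [Finite M₂] [Finite M₃] in
/-- The image of an `S`-unramified global class under a change of coefficients is `S`-unramified (local
form, finite places). [cite: MilneADT2006, Ch. I §2 (unramified cohomology)] -/
theorem localization_map_mem_unramifiedSubgroup
    {N₁ N₂ : Type u} [AddCommGroup N₁] [TopologicalSpace N₁] [DiscreteTopology N₁]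
    [AddCommGroup N₂] [TopologicalSpace N₂] [DiscreteTopology N₂]
    {τ₁ : DiscreteGaloisModule K N₁} {τ₂ : DiscreteGaloisModule K N₂}
    (φ : τ₁.toContRepresentation →ⁱL τ₂.toContRepresentation) (w : HeightOneSpectrum (𝓞 K))
    {z : galoisCohomology τ₁ 1}
    (hz : galoisCohomology.localization τ₁ (Sum.inr w) 1 z ∈ unramifiedSubgroup (GaloisRep.toLocal w τ₁) 1) :
    galoisCohomology.localization τ₂ (Sum.inr w) 1 (galoisCohomology.map φ 1 z) ∈
      unramifiedSubgroup (GaloisRep.toLocal w τ₂) 1 := by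
  change galoisCohomology.res τ₂ (w.adicCompletion K) 1 (galoisCohomology.map φ 1 z) ∈ _
  rw [galoisCohomology.res_map_one (w.adicCompletion K) φ z]
  exact map_mem_unramifiedSubgroup (ρ₁ := GaloisRep.restrictField (w.adicCompletion K) τ₁)
    (ρ₂ := GaloisRep.restrictField (w.adicCompletion K) τ₂) (φ.restrictField (w.adicCompletion K)) hz

/-- **DÉVISSAGE OF MILNE I THM. 4.10(b)** (see the module docstring for the statement and the proof).
[cite: MilneADT2006, Ch. I, Thm. 4.10(b), Lemma 4.8, Thm. 2.6, Prop. 0.19]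
[cite: Howard2004HeegnerKolyvagin, Thm. 2.1.11 (arXiv:1202.6340 p. 6)] -/
theorem middleExact_of_extension [Finite (TateDual K M₃ n)] (inv : LocalInvariants K n) (hperf : inv.IsPerfect)
    (hreal : inv.InjectiveAtRealPlaces) (hUO : inv.UnramifiedOrthogonal) (hsum : inv.SumLocalTermEqZero)
    {f : ρ₁.toContRepresentation →ⁱL ρ₂.toContRepresentation}
    {g : ρ₂.toContRepresentation →ⁱL ρ₃.toContRepresentation}
    (h : IsSES (homOfIntertwining f) (homOfIntertwining g))
    (hM₁ : ∀ m : M₁, n • m = 0) (hM₂ : ∀ m : M₂, n • m = 0)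
    (gD : (ρ₃.tateDual n).toContRepresentation →ⁱL (ρ₂.tateDual n).toContRepresentation)
    (hgD : ∀ (φ : TateDual K M₃ n) (m : M₂), gD φ m = φ (g m))
    (fD : (ρ₂.tateDual n).toContRepresentation →ⁱL (ρ₁.tateDual n).toContRepresentation)
    (hfD : ∀ (φ : TateDual K M₂ n) (m : M₁), fD φ m = φ (f m))
    {S : Finset (Place K)} (hSinf : ∀ w : InfinitePlace K, (Sum.inl w : Place K) ∈ S)
    (hS : ∀ v : HeightOneSpectrum (𝓞 K), (Sum.inr v : Place K) ∉ S →
      ((n : ℕ) : 𝓞 K) ∉ v.asIdeal ∧ GaloisRep.IsUnramifiedAt v ρ₁ ∧ GaloisRep.IsUnramifiedAt v ρ₂ ∧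
        GaloisRep.IsUnramifiedAt v ρ₃)
    -- Milne I 4.10(b) for `M₁` at every `S' ⊇ S`
    (hE₁ : ∀ S' : Finset (Place K), S ⊆ S' →
      ∀ t : Π v : Place K, galoisCohomology (ρ₁.toLocal v) 1,
        (∀ y : galoisCohomology (ρ₁.tateDual n) 1,
          (∀ v : HeightOneSpectrum (𝓞 K), (Sum.inr v : Place K) ∉ S' →
            galoisCohomology.localization (ρ₁.tateDual n) (Sum.inr v) 1 y ∈
              unramifiedSubgroup (GaloisRep.toLocal v (ρ₁.tateDual n)) 1) →
          ∑ v ∈ S', localTatePairingZMod ρ₁ n v (inv v) (t v)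
            (galoisCohomology.localization (ρ₁.tateDual n) v 1 y) = 0) →
        ∃ x : galoisCohomology ρ₁ 1,
          (∀ v : HeightOneSpectrum (𝓞 K), (Sum.inr v : Place K) ∉ S' →
            galoisCohomology.localization ρ₁ (Sum.inr v) 1 x ∈
              unramifiedSubgroup (GaloisRep.toLocal v ρ₁) 1) ∧
          ∀ v ∈ S', galoisCohomology.localization ρ₁ v 1 x = t v)
    -- Milne I 4.10(b) for `M₃` at `S`
    (hE₃ : ∀ t : Π v : Place K, galoisCohomology (ρ₃.toLocal v) 1,
        (∀ y : galoisCohomology (ρ₃.tateDual n) 1,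
          (∀ v : HeightOneSpectrum (𝓞 K), (Sum.inr v : Place K) ∉ S →
            galoisCohomology.localization (ρ₃.tateDual n) (Sum.inr v) 1 y ∈
              unramifiedSubgroup (GaloisRep.toLocal v (ρ₃.tateDual n)) 1) →
          ∑ v ∈ S, localTatePairingZMod ρ₃ n v (inv v) (t v)
            (galoisCohomology.localization (ρ₃.tateDual n) v 1 y) = 0) →
        ∃ x : galoisCohomology ρ₃ 1,
          (∀ v : HeightOneSpectrum (𝓞 K), (Sum.inr v : Place K) ∉ S →
            galoisCohomology.localization ρ₃ (Sum.inr v) 1 x ∈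
              unramifiedSubgroup (GaloisRep.toLocal v ρ₃) 1) ∧
          ∀ v ∈ S, galoisCohomology.localization ρ₃ v 1 x = t v)
    -- Milne I 4.10(b) for `M₃^D` at every `S' ⊇ S`
    (hE₃D : ∀ S' : Finset (Place K), S ⊆ S' →
      ∀ t : Π v : Place K, galoisCohomology ((ρ₃.tateDual n).toLocal v) 1,
        (∀ y : galoisCohomology ((ρ₃.tateDual n).tateDual n) 1,
          (∀ v : HeightOneSpectrum (𝓞 K), (Sum.inr v : Place K) ∉ S' →
            galoisCohomology.localization ((ρ₃.tateDual n).tateDual n) (Sum.inr v) 1 y ∈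
              unramifiedSubgroup (GaloisRep.toLocal v ((ρ₃.tateDual n).tateDual n)) 1) →
          ∑ v ∈ S', localTatePairingZMod (ρ₃.tateDual n) n v (inv v) (t v)
            (galoisCohomology.localization ((ρ₃.tateDual n).tateDual n) v 1 y) = 0) →
        ∃ x : galoisCohomology (ρ₃.tateDual n) 1,
          (∀ v : HeightOneSpectrum (𝓞 K), (Sum.inr v : Place K) ∉ S' →
            galoisCohomology.localization (ρ₃.tateDual n) (Sum.inr v) 1 x ∈
              unramifiedSubgroup (GaloisRep.toLocal v (ρ₃.tateDual n)) 1) ∧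
          ∀ v ∈ S', galoisCohomology.localization (ρ₃.tateDual n) v 1 x = t v)
    -- the obstruction groups
    (hSha₁ : ∀ z : galoisCohomology ρ₁ 2,
      (∀ v : Place K, galoisCohomology.localization ρ₁ v 2 z = 0) → z = 0)
    (hSha₃D : ∀ z : galoisCohomology (ρ₃.tateDual n) 2,
      (∀ v : Place K, galoisCohomology.localization (ρ₃.tateDual n) v 2 z = 0) → z = 0)
    (hH₁ : ∀ y : galoisCohomology (ρ₁.tateDual n) 1,
      (∀ v ∈ S, galoisCohomology.localization (ρ₁.tateDual n) v 1 y = 0) →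
      (∀ v : HeightOneSpectrum (𝓞 K), (Sum.inr v : Place K) ∉ S →
        galoisCohomology.localization (ρ₁.tateDual n) (Sum.inr v) 1 y ∈
          unramifiedSubgroup (GaloisRep.toLocal v (ρ₁.tateDual n)) 1) → y = 0)
    (hH₃D : ∀ y : galoisCohomology ((ρ₃.tateDual n).tateDual n) 1,
      (∀ v ∈ S, galoisCohomology.localization ((ρ₃.tateDual n).tateDual n) v 1 y = 0) →
      (∀ v : HeightOneSpectrum (𝓞 K), (Sum.inr v : Place K) ∉ S →
        galoisCohomology.localization ((ρ₃.tateDual n).tateDual n) (Sum.inr v) 1 y ∈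
          unramifiedSubgroup (GaloisRep.toLocal v ((ρ₃.tateDual n).tateDual n)) 1) → y = 0)
    -- the conclusion: Milne I 4.10(b) for `M₂` at `S`
    (t : Π v : Place K, galoisCohomology (ρ₂.toLocal v) 1)
    (horth : ∀ y : galoisCohomology (ρ₂.tateDual n) 1,
      (∀ v : HeightOneSpectrum (𝓞 K), (Sum.inr v : Place K) ∉ S →
        galoisCohomology.localization (ρ₂.tateDual n) (Sum.inr v) 1 y ∈
          unramifiedSubgroup (GaloisRep.toLocal v (ρ₂.tateDual n)) 1) →
      ∑ v ∈ S, localTatePairingZMod ρ₂ n v (inv v) (t v)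
        (galoisCohomology.localization (ρ₂.tateDual n) v 1 y) = 0) :
    ∃ x : galoisCohomology ρ₂ 1,
      (∀ v : HeightOneSpectrum (𝓞 K), (Sum.inr v : Place K) ∉ S →
        galoisCohomology.localization ρ₂ (Sum.inr v) 1 x ∈ unramifiedSubgroup (GaloisRep.toLocal v ρ₂) 1) ∧
      ∀ v ∈ S, galoisCohomology.localization ρ₂ v 1 x = t v := by
  classical
  haveI := absoluteGaloisGroup_compactSpace K
  have hD : IsSES (homOfIntertwining gD) (homOfIntertwining fD) := isSES_tateDual h hM₂ gD hgD fD hfD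
  have hM₃D : ∀ φ : TateDual K M₃ n, n • φ = 0 := fun φ => DiscreteGaloisModule.TateDual.nsmul_eq_zero φ
  -- STEP 1: push `t` to `M₃` and solve there
  let t₃ : Π v : Place K, galoisCohomology (ρ₃.toLocal v) 1 := fun v =>
    galoisCohomology.map (g.restrictField (Place.Completion v)) 1 (t v)
  have horth₃ : ∀ z : galoisCohomology (ρ₃.tateDual n) 1,
      (∀ v : HeightOneSpectrum (𝓞 K), (Sum.inr v : Place K) ∉ S →
        galoisCohomology.localization (ρ₃.tateDual n) (Sum.inr v) 1 z ∈
          unramifiedSubgroup (GaloisRep.toLocal v (ρ₃.tateDual n)) 1) →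
      ∑ v ∈ S, localTatePairingZMod ρ₃ n v (inv v) (t₃ v)
        (galoisCohomology.localization (ρ₃.tateDual n) v 1 z) = 0 := by
    intro z hz
    have hgz := horth (galoisCohomology.map gD 1 z) fun w hw => localization_map_mem_unramifiedSubgroup gD w (hz w hw)
    refine Eq.trans (Finset.sum_congr rfl fun v _ => ?_) hgz
    rw [localTatePairingZMod_map_eq g gD hgD v (inv v) (t v), localization_map_one' gD v z]
  obtain ⟨x₃, hx₃ur, hx₃S⟩ := hE₃ t₃ horth₃
  -- STEP 2: lift `x₃` to an `S`-unramified class of `M₂`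
  obtain ⟨x₂', hx₂'ur, hx₂'⟩ := exists_map_eq_of_unramifiedOutside inv hperf hreal hUO h hM₁ hSinf
    (fun v hv => ⟨(hS v hv).1, (hS v hv).2.1, (hS v hv).2.2.1⟩) hE₁ hSha₁ hH₁ x₃ hx₃ur
    (fun v hv => ⟨t v, (hx₃S v hv).symm⟩)
  -- STEP 3: the defect on `S` lies in `H¹(f)(H¹(K_v, M₁))`
  have hdef : ∀ v : Place K, ∃ a : galoisCohomology (ρ₁.toLocal v) 1, v ∈ S →
      galoisCohomology.map (f.restrictField (Place.Completion v)) 1 a =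
        galoisCohomology.localization ρ₂ v 1 x₂' - t v := by
    intro v
    by_cases hv : v ∈ S
    · have hv' := isSES_restrictField h (Place.Completion (K := K) v)
      have e1 : galoisCohomology.map (g.restrictField (Place.Completion v)) 1
          (galoisCohomology.localization ρ₂ v 1 x₂') = t₃ v := by
        rw [← localization_map_one' g v x₂', hx₂', hx₃S v hv]
      have hker : galoisCohomology.map (g.restrictField (Place.Completion v)) 1
          (galoisCohomology.localization ρ₂ v 1 x₂' - t v) = 0 :=
        (map_sub (galoisCohomology.map (g.restrictField (Place.Completion v)) 1)
          (galoisCohomology.localization ρ₂ v 1 x₂') (t v)).trans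
          ((congrArg (fun z => z - galoisCohomology.map (g.restrictField (Place.Completion v)) 1 (t v))
            e1).trans (sub_self _))
      obtain ⟨a, ha⟩ := hv'.exists_map_one_eq_of_map_one_eq_zero _ hker
      exact ⟨a, fun _ => ha⟩
    · exact ⟨0, fun h' => absurd h' hv⟩
  choose a ha using hdef
  -- the Selmer pair on `M₁`: `𝓕_v = ker H¹(f_v)` on `S`, `𝓖_v = ⊤` on `S`, unramified off `S`
  let 𝓖 : SelmerStructure ρ₁ := fun v =>
    match v with
    | Sum.inl _ => ⊤
    | Sum.inr w => if (Sum.inr w : Place K) ∈ S then ⊤ else unramifiedSubgroup (GaloisRep.toLocal w ρ₁) 1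
  let 𝓕 : SelmerStructure ρ₁ := fun v =>
    if v ∈ S then (galoisCohomology.map (f.restrictField (Place.Completion v)) 1).ker else 𝓖 v
  have h𝓖S : ∀ v : Place K, v ∈ S → 𝓖 v = ⊤ := fun v hv => by
    rcases v with w | w
    · rfl
    · change (if (Sum.inr w : Place K) ∈ S then ⊤ else unramifiedSubgroup (GaloisRep.toLocal w ρ₁) 1) = _
      rw [if_pos hv]
      rfl
  have h𝓖nS : ∀ w : HeightOneSpectrum (𝓞 K), (Sum.inr w : Place K) ∉ S →
      𝓖 (Sum.inr w) = unramifiedSubgroup (GaloisRep.toLocal w ρ₁) 1 := fun w hw => by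
    change (if (Sum.inr w : Place K) ∈ S then ⊤ else unramifiedSubgroup (GaloisRep.toLocal w ρ₁) 1) = _
    rw [if_neg hw]
  have h𝓕S : ∀ v : Place K, v ∈ S →
      𝓕 v = (galoisCohomology.map (f.restrictField (Place.Completion v)) 1).ker := fun v hv => by
    change (if v ∈ S then _ else 𝓖 v) = _
    rw [if_pos hv]
  have h𝓕nS : ∀ v : Place K, v ∉ S → 𝓕 v = 𝓖 v := fun v hv => by
    change (if v ∈ S then _ else 𝓖 v) = _
    rw [if_neg hv]
  have hle : 𝓕 ≤ 𝓖 := fun v => by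
    by_cases hv : v ∈ S
    · rw [h𝓖S v hv]; exact le_top
    · rw [h𝓕nS v hv]
  have h𝓖ur : 𝓖.IsUnramifiedOutside S := ⟨hSinf, h𝓖nS⟩
  have h𝓕ur : 𝓕.IsUnramifiedOutside S := ⟨hSinf, fun w hw => by rw [h𝓕nS _ hw]; exact h𝓖nS w hw⟩
  have hSρ₁ : ∀ v : HeightOneSpectrum (𝓞 K), (Sum.inr v : Place K) ∉ S →
      ((n : ℕ) : 𝓞 K) ∉ v.asIdeal ∧ GaloisRep.IsUnramifiedAt v ρ₁ := fun v hv => ⟨(hS v hv).1, (hS v hv).2.1⟩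
  have hdual := hUO.isUnramifiedOutside_dualSelmerStructure ρ₁ hM₁ hSρ₁ h𝓕ur
  -- orthogonality of the defect to `H¹_{𝓕*}(K, M₁^D)`
  have horthA : ∀ y ∈ (inv.dualSelmerStructure ρ₁ 𝓕).selmerGroup,
      ∑ v ∈ S, localTatePairingZMod ρ₁ n v (inv v) (a v)
        (galoisCohomology.localization (ρ₁.tateDual n) v 1 y) = 0 := by
    intro y hy
    rw [SelmerStructure.mem_selmerGroup_iff] at hy
    -- `y` is unramified off `S`
    have hyur : ∀ w : HeightOneSpectrum (𝓞 K), (Sum.inr w : Place K) ∉ S →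
        galoisCohomology.localization (ρ₁.tateDual n) (Sum.inr w) 1 y ∈
          unramifiedSubgroup (GaloisRep.toLocal w (ρ₁.tateDual n)) 1 := fun w hw => by
      rw [← hdual.2 w hw]
      exact hy (Sum.inr w)
    -- at `v ∈ S`, `loc_v y ∈ (ker H¹(f_v))^⊥ = im H¹(f_v^D)`
    have hyS : ∀ v ∈ S, ∃ Y : galoisCohomology ((ρ₂.tateDual n).toLocal v) 1,
        galoisCohomology.map (fD.restrictField (Place.Completion v)) 1 Y =
          galoisCohomology.localization (ρ₁.tateDual n) v 1 y := by
      intro v hv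
      have hyv := hy v
      rw [LocalInvariants.dualSelmerStructure_apply, h𝓕S v hv,
        LocalInvariants.mem_dualLocalCondition_iff] at hyv
      exact exists_map_tateDual_eq_of_forall_ker inv hperf hreal hM₁ hM₂ f fD hfD v _
        fun b hb => hyv b hb
    -- lift `y` to an `S`-unramified class `Y` of `M₂^D` (lifting lemma for the dual sequence)
    obtain ⟨Y, hYur, hY⟩ := exists_map_eq_of_unramifiedOutside (ρ₁ := ρ₃.tateDual n)
      (ρ₂ := ρ₂.tateDual n) (ρ₃ := ρ₁.tateDual n) inv hperf hreal hUO hD hM₃D hSinf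
      (fun v hv => ⟨(hS v hv).1, isUnramifiedAt_tateDual ρ₃ v (hS v hv).1 (hS v hv).2.2.2,
        isUnramifiedAt_tateDual ρ₂ v (hS v hv).1 (hS v hv).2.2.1⟩) hE₃D hSha₃D hH₃D y hyur hyS
    -- reciprocity for `(x₂', Y)` and the hypothesis on `t`
    let 𝓖₂ : SelmerStructure ρ₂ := fun v =>
      match v with
      | Sum.inl _ => ⊤
      | Sum.inr w => if (Sum.inr w : Place K) ∈ S then ⊤ else unramifiedSubgroup (GaloisRep.toLocal w ρ₂) 1
    let 𝓕₂ : SelmerStructure ρ₂ := fun v => if v ∈ S then ⊥ else 𝓖₂ v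
    have h𝓖₂nS : ∀ w : HeightOneSpectrum (𝓞 K), (Sum.inr w : Place K) ∉ S →
        𝓖₂ (Sum.inr w) = unramifiedSubgroup (GaloisRep.toLocal w ρ₂) 1 := fun w hw => by
      change (if (Sum.inr w : Place K) ∈ S then ⊤ else unramifiedSubgroup (GaloisRep.toLocal w ρ₂) 1) = _
      rw [if_neg hw]
    have h𝓖₂S : ∀ v : Place K, v ∈ S → 𝓖₂ v = ⊤ := fun v hv => by
      rcases v with w | w
      · rfl
      · change (if (Sum.inr w : Place K) ∈ S then ⊤ else unramifiedSubgroup (GaloisRep.toLocal w ρ₂) 1) = _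
        rw [if_pos hv]
        rfl
    have h𝓕₂S : ∀ v : Place K, v ∈ S → 𝓕₂ v = ⊥ := fun v hv => by
      change (if v ∈ S then ⊥ else 𝓖₂ v) = _
      rw [if_pos hv]
    have h𝓕₂nS : ∀ v : Place K, v ∉ S → 𝓕₂ v = 𝓖₂ v := fun v hv => by
      change (if v ∈ S then ⊥ else 𝓖₂ v) = _
      rw [if_neg hv]
    have h𝓕₂ur : 𝓕₂.IsUnramifiedOutside S := ⟨hSinf, fun w hw => by rw [h𝓕₂nS _ hw]; exact h𝓖₂nS w hw⟩
    have hSρ₂ : ∀ v : HeightOneSpectrum (𝓞 K), (Sum.inr v : Place K) ∉ S →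
        ((n : ℕ) : 𝓞 K) ∉ v.asIdeal ∧ GaloisRep.IsUnramifiedAt v ρ₂ :=
      fun v hv => ⟨(hS v hv).1, (hS v hv).2.2.1⟩
    have hdual₂ := hUO.isUnramifiedOutside_dualSelmerStructure ρ₂ hM₂ hSρ₂ h𝓕₂ur
    have hx₂'𝓖 : x₂' ∈ 𝓖₂.selmerGroup := by
      rw [SelmerStructure.mem_selmerGroup_iff]
      intro v
      by_cases hv : v ∈ S
      · rw [h𝓖₂S v hv]; exact AddSubgroup.mem_top _
      · rcases v with w | w
        · exact absurd (hSinf w) hv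
        · rw [h𝓖₂nS w hv]; exact hx₂'ur w hv
    have hY𝓕 : Y ∈ (inv.dualSelmerStructure ρ₂ 𝓕₂).selmerGroup := by
      rw [SelmerStructure.mem_selmerGroup_iff]
      intro v
      by_cases hv : v ∈ S
      · rw [LocalInvariants.dualSelmerStructure_apply, h𝓕₂S v hv, LocalInvariants.dualLocalCondition_bot]
        exact AddSubgroup.mem_top _
      · rcases v with w | w
        · exact absurd (hSinf w) hv
        · rw [hdual₂.2 w hv]; exact hYur w hv
    have hrec : ∑ v ∈ S, inv.localTerm ρ₂ v x₂' Y = 0 :=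
      hsum.sum_localTerm_selmer_eq_zero ρ₂ hM₂ (fun v hv => by rw [h𝓕₂nS v hv]) hx₂'𝓖 hY𝓕
    have ht0 := horth Y hYur
    -- assemble
    have e : ∀ v ∈ S, localTatePairingZMod ρ₁ n v (inv v) (a v)
        (galoisCohomology.localization (ρ₁.tateDual n) v 1 y) =
        inv.localTerm ρ₂ v x₂' Y - localTatePairingZMod ρ₂ n v (inv v) (t v)
          (galoisCohomology.localization (ρ₂.tateDual n) v 1 Y) := by
      intro v hv
      have h1 : galoisCohomology.localization (ρ₁.tateDual n) v 1 y =
          galoisCohomology.map (fD.restrictField (Place.Completion v)) 1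
            (galoisCohomology.localization (ρ₂.tateDual n) v 1 Y) := by
        rw [← hY]; exact localization_map_one' fD v Y
      have h2 := localTatePairingZMod_map_eq f fD hfD v (inv v) (a v)
        (galoisCohomology.localization (ρ₂.tateDual n) v 1 Y)
      have h3 : localTatePairingZMod ρ₂ n v (inv v)
          (galoisCohomology.map (f.restrictField (Place.Completion v)) 1 (a v)) =
          localTatePairingZMod ρ₂ n v (inv v) (galoisCohomology.localization ρ₂ v 1 x₂') -
            localTatePairingZMod ρ₂ n v (inv v) (t v) := by
        rw [ha v hv]; exact map_sub _ _ _
      rw [h1, ← h2, h3, AddMonoidHom.sub_apply]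
      rfl
    rw [Finset.sum_congr rfl e, Finset.sum_sub_distrib, hrec, ht0, sub_zero]
  -- Howard's Thm. 2.1.11 for `M₁` at `S`
  obtain ⟨xA, hxA𝓖, hxA⟩ := exists_selmer_sub_mem_of_middleExact inv hperf hreal hUO ρ₁ hM₁ hSρ₁
    (hE₁ S subset_rfl) hle h𝓕ur h𝓖ur a (fun v hv => by rw [h𝓖S v hv]; exact AddSubgroup.mem_top _) horthA
  rw [SelmerStructure.mem_selmerGroup_iff] at hxA𝓖
  -- STEP 4: the corrected class
  refine ⟨x₂' - galoisCohomology.map f 1 xA, fun w hw => ?_, fun v hv => ?_⟩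
  · rw [map_sub]
    refine sub_mem (hx₂'ur w hw) (localization_map_mem_unramifiedSubgroup f w ?_)
    have h1 := hxA𝓖 (Sum.inr w)
    rwa [h𝓖nS w hw] at h1
  · have h1 := hxA v hv
    rw [h𝓕S v hv] at h1
    have h1' : galoisCohomology.map (f.restrictField (Place.Completion v)) 1
        (galoisCohomology.localization ρ₁ v 1 xA - a v) = 0 := h1
    have h4 : galoisCohomology.map (f.restrictField (Place.Completion v)) 1
          (galoisCohomology.localization ρ₁ v 1 xA) -
        galoisCohomology.map (f.restrictField (Place.Completion v)) 1 (a v) = 0 :=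
      (map_sub _ _ _).symm.trans h1'
    -- `loc_v (H¹(f) x_A) = H¹(f_v)(a_v) = loc_v x₂' - t_v`
    have h3 : galoisCohomology.localization ρ₂ v 1 (galoisCohomology.map f 1 xA) =
        galoisCohomology.localization ρ₂ v 1 x₂' - t v :=
      (localization_map_one' f v xA).trans ((sub_eq_zero.mp h4).trans (ha v hv))
    rw [map_sub, h3, sub_sub_cancel]

end Summit.BirchSwinnertonDyer.BirchSwinnertonDyer.Theorems.KolyvaginRoadThreePT

end
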